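import Literature.NumberTheory.Sieve.LinearEquationsInPrimesCount
import Literature.NumberTheory.LFunctions.PrimeNumberTheoremErrorTermProofs
import HarnessLib

/-!
# Route `LeeYangFibres`, crux `AbsoluteUpgrade` (stmt-Parity-14116), line `nlc-cells-absolute-clip`:
# helpers for the registered stub `stub_cellsToDimOne : PrimeCellsAbsolute → DimOne`

The stub (file `LeeYangFibresAbsoluteUpgradeCellsToDimOne`) is partial summation WITH A RATE:
the absolute prime-cell asymptotic `C = M (A₁/N)^t ± ε N / log^t N` at some roughness
`u(N) ≥ 2` gives the `Λ`-weighted `d = 1` statement with absolute error `ε N`, although the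
singular mass `M = β_∞ ∏_p β_p` may be as large as `G N`, `G ≍ (log log N)^{t-1}`.  This file
holds the inputs of that passage which do not mention the route:

* `pow_near_one`: `(1 ± η)^t = 1 ± O(t η)`;
* `eventually_loglog`: `(A log log N + B)(log log N)^n ≤ c log N` eventually;
* `exists_primeCounting_rate`: the prime number theorem with the rate `1/log`,
  `|π(N) log N - N| ≤ C N / log N` (de la Vallée Poussin,
  `Literature.NumberTheory.LFunctions.ChebyshevThetaDeLaValleePoussin_holds`, and Mathlib's
  `Chebyshev.primeCounting_sub_theta_div_log_isBigO`);
* `cells_arith_abs`: the real-arithmetic heart (`|S - M| ≤ δ M + 2(E₁ + E₂ + E₃)`);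
* `errorCounts_le`: the points with a small value, a higher prime-power value, or a prime value
  `≤ N^{1/u} ≤ √N` weigh `≤ ε N / 16` (crude counts, as in `LeeYangFibresCellsToRelativeDimOne`);
* `mainTerm_window`: `κ = (A₁ log N / N)^t = 1 ± O(t (C_π + 1)/log N)`, `|M κ - M| ≤ ε N / 8`.

References: B. Green, T. Tao, *Linear equations in primes*, Ann. of Math. 171 (2010), sketch proof
of Conj. 1.4 after (1.8) [GreenTao2010]; H. L. Montgomery, R. C. Vaughan, *Multiplicative Number
Theory I* (2007), Theorem 6.9 [MontgomeryVaughan2007].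
-/

noncomputable section

namespace Summit.Parity.GeneralizedHardyLittlewood.Theorems.AbsoluteUpgrade

open Filter Finset Asymptotics
open scoped Topology
open Literature.NumberTheory.Sieve Literature.NumberTheory.LFunctions

/-! ### Analytic inputs -/

/-- `(1 ± η)^t` is within `2 t η` of `1` for `0 ≤ η ≤ 1`, `t η ≤ 1/2`:
`(1 + η)^t ≤ exp(t η) ≤ 1 + 2 t η` and Bernoulli's `1 - t η ≤ (1 - η)^t`. [folklore] -/
theorem pow_near_one (t : ℕ) {η : ℝ} (hη0 : 0 ≤ η) (hη1 : η ≤ 1) (hηt : t * η ≤ 1 / 2) :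
    (1 + η) ^ t ≤ 1 + 2 * t * η ∧ 1 - t * η ≤ (1 - η) ^ t := by
  constructor
  · have h1 : (1 + η) ^ t ≤ Real.exp (t * η) := by
      rw [Real.exp_nat_mul]
      exact pow_le_pow_left₀ (by linarith) (by linarith [Real.add_one_le_exp η]) t
    have h2 : |(t : ℝ) * η| ≤ 1 := by
      rw [abs_of_nonneg (by positivity)]
      linarith
    have h3 := (abs_le.mp (Real.abs_exp_sub_one_sub_id_le h2)).2
    have h4 : ((t : ℝ) * η) ^ 2 ≤ t * η := by
      rw [sq]
      exact (mul_le_mul_of_nonneg_left (by linarith) (by positivity)).trans (mul_one _).le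
    linarith
  · have h := one_add_mul_le_pow (a := -η) (by linarith) t
    rw [← sub_eq_add_neg] at h
    linarith

/-- `(A log log N + B)(log log N)^n ≤ c log N` eventually, for any reals `A, B` and `c > 0`
(`(log log N)^{n+1} = o(log N)`), together with `1 ≤ log log N`. [folklore] -/
theorem eventually_loglog (n : ℕ) (A B : ℝ) {c : ℝ} (hc : 0 < c) :
    ∀ᶠ N : ℕ in atTop, 1 ≤ Real.log (Real.log N) ∧
      (A * Real.log (Real.log N) + B) * Real.log (Real.log N) ^ n ≤ c * Real.log N := by
  have hD : 0 < |A| + |B| + 1 := by positivity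
  have h0 : ∀ᶠ x : ℝ in atTop, 1 ≤ Real.log x := Real.tendsto_log_atTop.eventually_ge_atTop 1
  have h1 : ∀ᶠ x : ℝ in atTop, 1 ≤ Real.log (Real.log x) :=
    (Real.tendsto_log_atTop.comp Real.tendsto_log_atTop).eventually_ge_atTop 1
  have h2 : ∀ᶠ x : ℝ in atTop,
      Real.log (Real.log x) ^ (n + 1) ≤ c / (|A| + |B| + 1) * Real.log x := by
    have := ((Real.isLittleO_pow_log_id_atTop (n := n + 1)).comp_tendsto
      Real.tendsto_log_atTop).bound (div_pos hc hD)
    filter_upwards [this, h0, h1] with x hx hx0 hx1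
    simp only [Function.comp_apply, id_eq, Real.norm_eq_abs] at hx
    rwa [abs_of_nonneg (by positivity : (0 : ℝ) ≤ Real.log (Real.log x) ^ (n + 1)),
      abs_of_nonneg (by linarith : (0 : ℝ) ≤ Real.log x)] at hx
  refine (tendsto_natCast_atTop_atTop.eventually (h1.and h2)).mono fun N hN => ?_
  obtain ⟨hN1, hN2⟩ := hN
  refine ⟨hN1, ?_⟩
  set Λ : ℝ := Real.log (Real.log N)
  have hΛ0 : 0 ≤ Λ := by linarith
  have hΛn : 0 ≤ Λ ^ n := pow_nonneg hΛ0 n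
  have hA : A * Λ ≤ |A| * Λ := mul_le_mul_of_nonneg_right (le_abs_self A) hΛ0
  have hB : B ≤ |B| * Λ := (le_abs_self B).trans (le_mul_of_one_le_right (abs_nonneg B) hN1)
  have h3 : (A * Λ + B) * Λ ^ n ≤ (|A| + |B|) * Λ ^ (n + 1) := by
    calc (A * Λ + B) * Λ ^ n ≤ (|A| * Λ + |B| * Λ) * Λ ^ n :=
          mul_le_mul_of_nonneg_right (add_le_add hA hB) hΛn
      _ = (|A| + |B|) * Λ ^ (n + 1) := by ring
  have h4 : (|A| + |B|) * Λ ^ (n + 1) ≤ (|A| + |B|) * (c / (|A| + |B| + 1) * Real.log N) :=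
    mul_le_mul_of_nonneg_left hN2 (by positivity)
  have h5 : (|A| + |B|) * (c / (|A| + |B| + 1)) ≤ c := by
    rw [mul_div_assoc', div_le_iff₀ hD]
    nlinarith [abs_nonneg A, abs_nonneg B]
  have hlog0 : 0 ≤ Real.log N := Real.log_natCast_nonneg N
  calc (A * Λ + B) * Λ ^ n ≤ (|A| + |B|) * (c / (|A| + |B| + 1) * Real.log N) := h3.trans h4
    _ = (|A| + |B|) * (c / (|A| + |B| + 1)) * Real.log N := by ring
    _ ≤ c * Real.log N := mul_le_mul_of_nonneg_right h5 hlog0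

/-- **Prime number theorem with the rate `1/log`.** There is `C ≥ 0` with
`|π(N) log N - N| ≤ C N / log N` for all large `N`: de la Vallée Poussin's
`ϑ(x) = x + O(x / log x)` (`ChebyshevThetaDeLaValleePoussin_holds.logPow`) and
`π(x) - ϑ(x)/log x = O(x / log² x)` (Mathlib's `Chebyshev.primeCounting_sub_theta_div_log_isBigO`).
[cite: MontgomeryVaughan2007, Theorem 6.9] -/
theorem exists_primeCounting_rate :
    ∃ C : ℝ, 0 ≤ C ∧ ∀ᶠ N : ℕ in atTop,
      |(Nat.primeCounting N : ℝ) * Real.log N - N| ≤ C * N / Real.log N := by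
  obtain ⟨C₁, hC₁⟩ := ChebyshevThetaDeLaValleePoussin_holds.logPow 1
  obtain ⟨C₂, hC₂⟩ := Chebyshev.primeCounting_sub_theta_div_log_isBigO.bound
  refine ⟨|C₁| + |C₂|, by positivity, ?_⟩
  have h3 : ∀ᶠ x : ℝ in atTop, |(Nat.primeCounting ⌊x⌋₊ : ℝ) * Real.log x - x| ≤
      (|C₁| + |C₂|) * x / Real.log x := by
    filter_upwards [hC₂, eventually_ge_atTop (3 : ℝ)] with x hx hx3
    have hx0 : 0 < x := by linarith
    have hlog1 : 1 < Real.log x := by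
      rw [Real.lt_log_iff_exp_lt hx0]
      linarith [Real.exp_one_lt_d9]
    have hlog0 : 0 < Real.log x := by linarith
    have hlogne : Real.log x ≠ 0 := hlog0.ne'
    have hθ := hC₁ x (by linarith)
    rw [Real.rpow_one] at hθ
    rw [Real.norm_eq_abs, Real.norm_eq_abs,
      abs_of_nonneg (by positivity : (0 : ℝ) ≤ x / Real.log x ^ 2)] at hx
    have key : (Nat.primeCounting ⌊x⌋₊ : ℝ) * Real.log x - x =
        Real.log x * ((Nat.primeCounting ⌊x⌋₊ : ℝ) - Chebyshev.theta x / Real.log x) +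
          (Chebyshev.theta x - x) := by
      rw [mul_sub, mul_div_cancel₀ _ hlogne]
      ring
    rw [key]
    calc |Real.log x * ((Nat.primeCounting ⌊x⌋₊ : ℝ) - Chebyshev.theta x / Real.log x) +
          (Chebyshev.theta x - x)|
        ≤ |Real.log x * ((Nat.primeCounting ⌊x⌋₊ : ℝ) - Chebyshev.theta x / Real.log x)| +
          |Chebyshev.theta x - x| := abs_add_le _ _
      _ = Real.log x * |(Nat.primeCounting ⌊x⌋₊ : ℝ) - Chebyshev.theta x / Real.log x| +
          |Chebyshev.theta x - x| := by rw [abs_mul, abs_of_pos hlog0]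
      _ ≤ Real.log x * (C₂ * (x / Real.log x ^ 2)) + C₁ * x / Real.log x :=
          add_le_add (mul_le_mul_of_nonneg_left hx hlog0.le) hθ
      _ = (C₂ + C₁) * x / Real.log x := by
          field_simp
      _ ≤ (|C₁| + |C₂|) * x / Real.log x :=
          div_le_div_of_nonneg_right (mul_le_mul_of_nonneg_right
            (by linarith [le_abs_self C₁, le_abs_self C₂]) hx0.le) hlog0.le
  refine (tendsto_natCast_atTop_atTop.eventually h3).mono fun N hN => ?_
  simpa only [Nat.floor_natCast] using hN

/-! ### The arithmetic heart -/

/-- **Arithmetic heart, absolute form.** From the sandwich `(1-δ) Tg ≤ S ≤ (1+δ)(Tg + Tb + Tc)`,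
the comparison `TC - Tb ≤ Tg ≤ TC + Tb₂` of the good points with the cells, the cell asymptotic
`|TC - MK| ≤ E₁`, the main-term comparison `|MK - M| ≤ E₂` and the smallness `Tb + Tc + Tb₂ ≤ E₃`
of the error counts: `|S - M| ≤ δ M + 2 (E₁ + E₂ + E₃)` (`M ≥ 0`, `0 ≤ δ ≤ 1`).  Registered sub-goal of
the line (signature verbatim on one line). [folklore] -/
theorem cells_arith_abs : ∀ {S M Tg Tb Tc Tb2 TC MK δ E₁ E₂ E₃ : ℝ}, 0 ≤ δ → δ ≤ 1 → 0 ≤ M → 0 ≤ Tb → 0 ≤ Tc → 0 ≤ Tb2 → (1 - δ) * Tg ≤ S → S ≤ (1 + δ) * (Tg + Tb + Tc) → TC - Tb ≤ Tg → Tg ≤ TC + Tb2 → |TC - MK| ≤ E₁ → |MK - M| ≤ E₂ → Tb + Tc + Tb2 ≤ E₃ → |S - M| ≤ δ * M + 2 * (E₁ + E₂ + E₃) := by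
  intro S M Tg Tb Tc Tb2 TC MK δ E₁ E₂ E₃ hδ0 hδ1 hM hTb hTc hTb2 hS1 hS2 hG1 hG2 hP hK hE
  obtain ⟨hP1, hP2⟩ := abs_le.mp hP
  obtain ⟨hK1, hK2⟩ := abs_le.mp hK
  have hEpos : 0 ≤ E₁ + E₂ + E₃ := by
    linarith [abs_nonneg (TC - MK), abs_nonneg (MK - M)]
  have hup : Tg + Tb + Tc ≤ M + (E₁ + E₂ + E₃) := by linarith
  have hup2 : (1 + δ) * (Tg + Tb + Tc) ≤ (1 + δ) * (M + (E₁ + E₂ + E₃)) :=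
    mul_le_mul_of_nonneg_left hup (by linarith)
  have hlo : M - (E₁ + E₂ + E₃) ≤ Tg := by linarith
  have hlo2 : (1 - δ) * (M - (E₁ + E₂ + E₃)) ≤ (1 - δ) * Tg :=
    mul_le_mul_of_nonneg_left hlo (by linarith)
  have hδE : δ * (E₁ + E₂ + E₃) ≤ 1 * (E₁ + E₂ + E₃) := mul_le_mul_of_nonneg_right hδ1 hEpos
  have hδE0 : 0 ≤ δ * (E₁ + E₂ + E₃) := mul_nonneg hδ0 hEpos
  have hδM : 0 ≤ δ * M := mul_nonneg hδ0 hM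
  rw [abs_le]
  constructor
  · linarith
  · linarith

/-! ### The error counts -/

/-- **The three error counts are `o(N)`.** With `ℓ = log N`, threshold `Y = N / ℓ^{t+1}` and the
crude bounds of the sandwich (`β ≤ t(2Y+1)` points with a value `≤ Y`, `γ ≤ t √(2LN) log₂(2LN)`
points with a higher prime-power value), plus the `≤ t(2N^{1/u}+1)` prime points with a prime value
`≤ N^{1/u} ≤ √N`: after weighting by `ℓ^t` all three are `≤ ε N / 16` once `144 t ≤ ε ℓ`,
`ℓ^{t+1} ≤ N` and `ℓ^{t+1} ≤ c₂ √N` with `12 t (√(2L) + 1) c₂ ≤ ε / 16`.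
[cite: GreenTao2010, Conj. 1.4 (sketch proof)] -/
theorem errorCounts_le {t L N u : ℕ} {ε c₂ β γ : ℝ} (ht : 1 ≤ t) (hN3 : 3 ≤ N) (hu2 : 2 ≤ u)
    (hε : 0 < ε) (hc₂0 : 0 < c₂) (hc₂ : 12 * t * (Real.sqrt (2 * L) + 1) * c₂ ≤ ε / 16)
    (hℓt : 144 * t ≤ ε * Real.log N) (hℓpow : Real.log N ^ (t + 1) ≤ 1 * N)
    (hℓsqrt : Real.log N ^ (t + 1) ≤ c₂ * Real.sqrt N)
    (hb2 : Real.log (2 * L * N) ≤ 2 * Real.log N)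
    (hβle : β ≤ t * (2 * (N / Real.log N ^ (t + 1)) + 1))
    (hγle : γ ≤ t * ((Nat.sqrt (2 * L * N) : ℝ) * (Nat.log 2 (2 * L * N) : ℝ))) :
    Real.log N ^ t * β + Real.log N ^ t * γ +
      Real.log N ^ t * (t * (2 * (N : ℝ) ^ ((1 : ℝ) / u) + 1)) ≤ ε / 16 * N := by
  -- adapted from `LeeYangFibresCells.abs_vonMangoldtSum_sub_le_of_cells` (relative template)
  have hN1 : 1 ≤ N := by omega
  have hx1 : (1 : ℝ) ≤ N := by exact_mod_cast hN1
  have hx3 : (3 : ℝ) ≤ N := by exact_mod_cast hN3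
  have hx0 : (0 : ℝ) < N := by linarith
  have ht0 : (0 : ℝ) < t := by exact_mod_cast ht
  have hℓ1 : 1 < Real.log N := by
    rw [Real.lt_log_iff_exp_lt hx0]
    linarith [Real.exp_one_lt_d9]
  set ℓ : ℝ := Real.log N with hℓdef
  have hℓ0 : 0 < ℓ := by linarith
  set T : ℝ := ℓ ^ t with hTdef
  have hT : 0 < T := pow_pos hℓ0 t
  have hℓt1 : 0 < ℓ ^ (t + 1) := pow_pos hℓ0 _
  have hTℓ : T * ℓ = ℓ ^ (t + 1) := by rw [hTdef, pow_succ]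
  have hTle : T ≤ ℓ ^ (t + 1) := by
    rw [← hTℓ]
    exact le_mul_of_one_le_right hT.le hℓ1.le
  have hεN : 0 ≤ ε * N := by positivity
  set Y : ℝ := N / ℓ ^ (t + 1) with hYdef
  have hY1 : 1 ≤ Y := by
    rw [hYdef, le_div_iff₀ hℓt1, one_mul]
    linarith only [hℓpow]
  have hZ : (N : ℝ) ^ ((1 : ℝ) / u) ≤ Real.sqrt N := by
    rw [Real.sqrt_eq_rpow]
    refine Real.rpow_le_rpow_of_exponent_le hx1 ?_
    have hu : (2 : ℝ) ≤ u := by exact_mod_cast hu2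
    exact one_div_le_one_div_of_le two_pos hu
  have hsx : Real.sqrt N * Real.sqrt N = N := Real.mul_self_sqrt hx0.le
  have hs1 : 1 ≤ Real.sqrt (N : ℝ) := by
    rw [show (1 : ℝ) = Real.sqrt 1 from Real.sqrt_one.symm]
    exact Real.sqrt_le_sqrt hx1
  have hsL0 : 0 ≤ Real.sqrt (2 * (L : ℝ)) := Real.sqrt_nonneg _
  -- the points with a small value
  have hTY : T * Y * ℓ = N := by
    calc T * Y * ℓ = Y * (T * ℓ) := by ring
      _ = Y * ℓ ^ (t + 1) := by rw [hTℓ]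
      _ = N := div_mul_cancel₀ _ hℓt1.ne'
  have hEb : T * β ≤ ε / 48 * N := by
    have h1 : T * β ≤ 3 * t * (T * Y) := by
      calc T * β ≤ T * (t * (2 * Y + 1)) := mul_le_mul_of_nonneg_left hβle hT.le
        _ ≤ T * (t * (3 * Y)) :=
            mul_le_mul_of_nonneg_left (mul_le_mul_of_nonneg_left (by linarith only [hY1]) ht0.le)
              hT.le
        _ = 3 * t * (T * Y) := by ring
    have h2 : 3 * t * (T * Y) * ℓ ≤ ε / 48 * N * ℓ := by
      calc 3 * t * (T * Y) * ℓ = 3 * t * (T * Y * ℓ) := by ring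
        _ = 3 * t * N := by rw [hTY]
        _ = (144 * t) * N / 48 := by ring
        _ ≤ (ε * ℓ) * N / 48 :=
            div_le_div_of_nonneg_right (mul_le_mul_of_nonneg_right hℓt hx0.le) (by norm_num)
        _ = ε / 48 * N * ℓ := by ring
    exact h1.trans (le_of_mul_le_mul_right h2 hℓ0)
  -- the points with a higher prime-power value
  have hEc : T * γ ≤ ε / 48 * N := by
    have hs : (Nat.sqrt (2 * L * N) : ℝ) ≤ Real.sqrt (2 * L) * Real.sqrt N := by
      have h1 := Real.nat_sqrt_le_real_sqrt (a := 2 * L * N)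
      push_cast at h1
      rwa [Real.sqrt_mul (by positivity)] at h1
    have hlg : (Nat.log 2 (2 * L * N) : ℝ) ≤ 4 * ℓ := by
      have h1 : ((Nat.log 2 (2 * L * N) : ℕ) : ℝ) ≤ Real.logb 2 (2 * L * N) := by
        have := Real.natLog_le_logb (2 * L * N) 2
        exact_mod_cast this
      have h2 : Real.logb 2 (2 * (L : ℝ) * N) ≤ 4 * ℓ := by
        rw [Real.logb, div_le_iff₀ (Real.log_pos one_lt_two)]
        have h4 := Real.log_two_gt_d9
        have h5 : 1 / 2 * ℓ ≤ Real.log 2 * ℓ :=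
          mul_le_mul_of_nonneg_right (by linarith only [h4]) hℓ0.le
        linarith only [hb2, h5, hℓ0]
      exact h1.trans h2
    have hkey : 4 * t * Real.sqrt (2 * L) * c₂ ≤ ε / 48 := by
      have h1 : 4 * t * Real.sqrt (2 * L) * c₂ ≤ 4 * t * (Real.sqrt (2 * L) + 1) * c₂ :=
        mul_le_mul_of_nonneg_right
          (mul_le_mul_of_nonneg_left (by linarith only) (by positivity)) hc₂0.le
      linarith only [h1, hc₂]
    calc T * γ
        ≤ T * (t * ((Nat.sqrt (2 * L * N) : ℝ) * (Nat.log 2 (2 * L * N) : ℝ))) :=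
          mul_le_mul_of_nonneg_left hγle hT.le
      _ ≤ T * (t * (Real.sqrt (2 * L) * Real.sqrt N * (4 * ℓ))) :=
          mul_le_mul_of_nonneg_left (mul_le_mul_of_nonneg_left
            (mul_le_mul hs hlg (Nat.cast_nonneg _) (by positivity)) ht0.le) hT.le
      _ = 4 * t * Real.sqrt (2 * L) * Real.sqrt N * (T * ℓ) := by ring
      _ ≤ 4 * t * Real.sqrt (2 * L) * Real.sqrt N * (c₂ * Real.sqrt N) := by
          refine mul_le_mul_of_nonneg_left ?_ (by positivity)
          rw [hTℓ]
          exact hℓsqrt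
      _ = 4 * t * Real.sqrt (2 * L) * c₂ * (Real.sqrt N * Real.sqrt N) := by ring
      _ = 4 * t * Real.sqrt (2 * L) * c₂ * N := by rw [hsx]
      _ ≤ ε / 48 * N := mul_le_mul_of_nonneg_right hkey hx0.le
  -- the prime points with a prime value `≤ N^{1/u}`
  have hEb2 : T * (t * (2 * (N : ℝ) ^ ((1 : ℝ) / u) + 1)) ≤ ε / 64 * N := by
    have hkey : 3 * t * c₂ ≤ ε / 64 := by
      have h1 : 3 * t * c₂ ≤ 3 * t * (Real.sqrt (2 * L) + 1) * c₂ := by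
        have h2 : 3 * (t : ℝ) * 1 ≤ 3 * t * (Real.sqrt (2 * L) + 1) :=
          mul_le_mul_of_nonneg_left (by linarith only [hsL0]) (by positivity)
        have := mul_le_mul_of_nonneg_right h2 hc₂0.le
        linarith only [this]
      linarith only [h1, hc₂]
    calc T * (t * (2 * (N : ℝ) ^ ((1 : ℝ) / u) + 1))
        ≤ T * (t * (2 * Real.sqrt N + Real.sqrt N)) :=
          mul_le_mul_of_nonneg_left (mul_le_mul_of_nonneg_left (by linarith only [hZ, hs1]) ht0.le)
            hT.le
      _ = 3 * t * Real.sqrt N * T := by ring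
      _ ≤ 3 * t * Real.sqrt N * (c₂ * Real.sqrt N) :=
          mul_le_mul_of_nonneg_left (hTle.trans hℓsqrt) (by positivity)
      _ = 3 * t * c₂ * (Real.sqrt N * Real.sqrt N) := by ring
      _ = 3 * t * c₂ * N := by rw [hsx]
      _ ≤ ε / 64 * N := mul_le_mul_of_nonneg_right hkey hx0.le
  linarith only [hEb, hEc, hEb2, hεN]

/-! ### The main-term window -/

/-- **The main-term window, with a rate.** From the prime number theorem with rate
`|π(N) ℓ - N| ≤ C_π N/ℓ` (`ℓ = log N`), `ℓ √N ≤ N/ℓ` and `π(N) - N^{1/u} ≤ A₁ ≤ π(N)` (`u ≥ 2`):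
`A₁ ℓ = (1 ± η') N` with `η' = (C_π + 1)/ℓ`, so `κ = (A₁ ℓ / N)^t ∈ [1 - t η', 1 + 2 t η']`
(`pow_near_one`), and for a mass `0 ≤ M ≤ G N` with `16 t (C_π + 1) G ≤ ε ℓ`:
`|M κ - M| ≤ 2 t η' G N ≤ ε N / 8`. [cite: MontgomeryVaughan2007, §8.1 eq. (8.1)] -/
theorem mainTerm_window {t N u : ℕ} {ε G Cπ A₁ M : ℝ} (ht : 1 ≤ t) (hN3 : 3 ≤ N) (hu2 : 2 ≤ u)
    (hε : 0 < ε) (hε1 : ε ≤ 1) (hG1 : 1 ≤ G) (hM0 : 0 ≤ M) (hMG : M ≤ G * N) (hCπ : 0 ≤ Cπ)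
    (hπ : |(Nat.primeCounting N : ℝ) * Real.log N - N| ≤ Cπ * N / Real.log N)
    (hkap : 16 * t * (Cπ + 1) * G ≤ ε * Real.log N)
    (hsℓ : Real.sqrt N * Real.log N ≤ N / Real.log N)
    (hA1 : (Nat.primeCounting N : ℝ) ≤ A₁ + (N : ℝ) ^ ((1 : ℝ) / u))
    (hA2 : A₁ ≤ Nat.primeCounting N) :
    |M * ((A₁ / N) ^ t * Real.log N ^ t) - M| ≤ ε / 8 * N := by
  have hN1 : 1 ≤ N := by omega
  have hx1 : (1 : ℝ) ≤ N := by exact_mod_cast hN1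
  have hx3 : (3 : ℝ) ≤ N := by exact_mod_cast hN3
  have hx0 : (0 : ℝ) < N := by linarith
  have ht1 : (1 : ℝ) ≤ t := by exact_mod_cast ht
  have hℓ1 : 1 < Real.log N := by
    rw [Real.lt_log_iff_exp_lt hx0]
    linarith [Real.exp_one_lt_d9]
  set ℓ : ℝ := Real.log N with hℓdef
  have hℓ0 : 0 < ℓ := by linarith
  have hεN : 0 ≤ ε * N := by positivity
  have hNℓ : 0 ≤ (N : ℝ) / ℓ := by positivity
  have hZ : (N : ℝ) ^ ((1 : ℝ) / u) ≤ Real.sqrt N := by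
    rw [Real.sqrt_eq_rpow]
    refine Real.rpow_le_rpow_of_exponent_le hx1 ?_
    have hu : (2 : ℝ) ≤ u := by exact_mod_cast hu2
    exact one_div_le_one_div_of_le two_pos hu
  -- `A₁ ℓ = (1 ± η') N`
  obtain ⟨hπ1, hπ2⟩ := abs_le.mp hπ
  set η' : ℝ := (Cπ + 1) / ℓ with hη'def
  have hη'0 : 0 ≤ η' := by positivity
  have hη'N : η' * N = Cπ * N / ℓ + N / ℓ := by rw [hη'def]; ring
  have hη'G : 16 * t * η' * G ≤ ε := by
    have h1 : 16 * t * η' * G * ℓ ≤ ε * ℓ := by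
      calc 16 * t * η' * G * ℓ = 16 * t * (η' * ℓ) * G := by ring
        _ = 16 * t * (Cπ + 1) * G := by rw [hη'def, div_mul_cancel₀ _ hℓ0.ne']
        _ ≤ ε * ℓ := hkap
    exact le_of_mul_le_mul_right h1 hℓ0
  have htη' : t * η' ≤ 1 / 16 := by
    have h1 : t * η' * 1 ≤ t * η' * G := mul_le_mul_of_nonneg_left hG1 (by positivity)
    linarith only [h1, hη'G, hε1]
  have hη'1 : η' ≤ 1 / 16 := by
    have : 1 * η' ≤ t * η' := mul_le_mul_of_nonneg_right ht1 hη'0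
    linarith only [this, htη']
  have hAlo : (1 - η') * N ≤ A₁ * ℓ := by
    have h1 : ((Nat.primeCounting N : ℝ) - (N : ℝ) ^ ((1 : ℝ) / u)) * ℓ ≤ A₁ * ℓ :=
      mul_le_mul_of_nonneg_right (by linarith only [hA1]) hℓ0.le
    have h2 : (N : ℝ) ^ ((1 : ℝ) / u) * ℓ ≤ N / ℓ :=
      (mul_le_mul_of_nonneg_right hZ hℓ0.le).trans hsℓ
    linarith only [h1, h2, hη'N, hπ1]
  have hAhi : A₁ * ℓ ≤ (1 + η') * N := by
    have h1 : A₁ * ℓ ≤ (Nat.primeCounting N : ℝ) * ℓ := mul_le_mul_of_nonneg_right hA2 hℓ0.le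
    linarith only [h1, hπ2, hη'N, hNℓ]
  have hA0 : 0 ≤ A₁ := by
    refine le_of_mul_le_mul_right ?_ hℓ0
    have : 0 ≤ (1 - η') * (N : ℝ) := mul_nonneg (by linarith only [hη'1]) hx0.le
    linarith only [this, hAlo]
  -- `κ = (A₁ ℓ / N)^t ∈ [1 - t η', 1 + 2 t η']`
  have hκeq : (A₁ / N) ^ t * ℓ ^ t = (A₁ * ℓ / N) ^ t := by
    rw [← mul_pow, div_mul_eq_mul_div]
  obtain ⟨hpow_hi, hpow_lo⟩ :=
    pow_near_one t hη'0 (by linarith only [hη'1]) (by linarith only [htη'])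
  have hκlo : 1 - t * η' ≤ (A₁ * ℓ / N) ^ t := by
    refine hpow_lo.trans (pow_le_pow_left₀ (by linarith only [hη'1]) ?_ t)
    rw [le_div_iff₀ hx0]
    exact hAlo
  have hκhi : (A₁ * ℓ / N) ^ t ≤ 1 + 2 * t * η' := by
    refine le_trans (pow_le_pow_left₀ (div_nonneg (mul_nonneg hA0 hℓ0.le) hx0.le) ?_ t) hpow_hi
    rw [div_le_iff₀ hx0]
    exact hAhi
  -- `|M κ - M| ≤ 2 t η' M ≤ ε N / 8`
  have hη'M : t * η' * M ≤ ε / 16 * N := by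
    calc t * η' * M ≤ t * η' * (G * N) := mul_le_mul_of_nonneg_left hMG (by positivity)
      _ = (16 * t * η' * G) * N / 16 := by ring
      _ ≤ ε * N / 16 :=
          div_le_div_of_nonneg_right (mul_le_mul_of_nonneg_right hη'G hx0.le) (by norm_num)
      _ = ε / 16 * N := by ring
  rw [hκeq]
  have h1 : M * (1 - t * η') ≤ M * (A₁ * ℓ / N) ^ t := mul_le_mul_of_nonneg_left hκlo hM0
  have h2 : M * (A₁ * ℓ / N) ^ t ≤ M * (1 + 2 * t * η') := mul_le_mul_of_nonneg_left hκhi hM0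
  rw [abs_le]
  constructor
  · linarith only [h1, hη'M, hεN]
  · linarith only [h2, hη'M, hεN]

end Summit.Parity.GeneralizedHardyLittlewood.Theorems.AbsoluteUpgrade

end
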